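import Literature.MathematicalPhysics.QuantumFieldTheory.Balaban1983to89.B11SectG
import Literature.MathematicalPhysics.QuantumFieldTheory.Balaban1983to89.T4EtaRateCoeffDefect
import Literature.MathematicalPhysics.QuantumFieldTheory.Balaban1983to89.B6BondEliminationTorus
import Literature.MathematicalPhysics.QuantumFieldTheory.Balaban1983to89.B6LowerBound2153Torus
import Literature.MathematicalPhysics.QuantumFieldTheory.Balaban1983to89.B5Blocks16
import Literature.MathematicalPhysics.QuantumFieldTheory.King1986.MinimizerTowerBridge

/-!
# `Balaban1983to89.B6UnitTorusCarrier` — the ONE-SCALE [B6] carrier of the b05 torus model: the unit torus `Π_ν ℤ∕M_ν` with the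
# periodic sup-distance as a `B6.Geometry`, its (2.54) and (2.61), and the block counts of the unit∕fine BOND assignments

T. Bałaban, *Propagators and renormalization transformations for lattice gauge theories. II*, Commun. Math. Phys. **96** (1984)
223–250 [`Balaban1984PropagatorsII`, cell paper B6].  PRINTED TEXT (locations only): (2.45)–(2.48) pp. 229–231 (the multiscale
carrier `𝔅 = ⋃_j Λ_j` and its distance `d(y, y′)`), (2.54) p. 233 («This is of course the triangle inequality for our distance.»),
Lemma 2.1 (2.61) p. 234 (`sup_y Σ_{y′} e^{−αδ₀d(y,y′)} ≤ c₁(α)`); B12 (1.9) p. 252 (distances «in the sense of a periodic distance on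
the torus»).  Nothing printed is a hypothesis; everything below is `[folklore]` bookkeeping on a finite torus.

WHAT THIS FILE PROVIDES (cell `pub-ymgap`, seat `pub-ymgap-dag-n15-a` g3; the CONCRETE CARRIER on which the -a chain's binder-(a) theorems
`Summits/…/BalabanUVNodesN15DefectKernel*` are instantiated hypothesis-free).  The ONE-SCALE instance of [B6]'s abstract carrier
`B6.Geometry` (every site at the top scale `k`, `L^kη = 1`, (2.1)–(2.2) void) whose sites are the points of the UNIT TORUS
`Tor M = Π_ν ℤ∕M_ν` of the b05 torus model and whose distance is King's periodic sup-distance `King1986.Torus.tdistT M`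
(argument∕cut-off sorts inert):
* §1 `unitTorusGeo L k M` and its readings (`unitTorusGeo_dist`, `_len`), (2.54) `triangle254_unitTorusGeo`, `dist_nonneg`, `dist_symm`,
  and (2.61) `rowSum_unitTorusGeo` (`Σ_{y′} e^{−σ|y − y′|_T} ≤ K_{d+1}(σ)`, `B4Sect5Proof.latticeConst`, UNIFORMLY in the volume —
  `King1986.Torus.tdistT_sumBound` BY NAME);
* §2 the BOND assignments of the N15 chain and their block counts: unit bonds `(y, λ) ↦ y` (`card_fibre_unitBond = d + 1`), fine bonds
  `(x, μ) ↦ B(x)` = King's `King1986.Torus.blockOf n M` (`card_fibre_fineBond = (d + 1)·n^{d+1}`, via b05's block parametrisation `B5Blocks16.bpt_bijective`);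
* §3 the dictionary between b06's periodic bond distance `B6BondEliminationTorus.pdist` on box representatives and `tdistT`
  (`res_rep`, `pdist_rep_rep : ρ_M(rep y, rep y′) = |y − y′|_T`).

HONEST FRAMING.  A finite-torus MODEL carrier (one scale, no large-field regions, inert localisation sorts) — plumbing for kernel
bookkeeping; NOT Bałaban's multiscale `𝔅`; nothing continuum ∕ mass-gap ∕ Clay; count-neutral for the cell's 27 nodes.
-/

noncomputable section

open scoped BigOperators
open Finset

namespace Literature.MathematicalPhysics.QuantumFieldTheory.Balaban1983to89.B6UnitTorusCarrier

open Literature.MathematicalPhysics.QuantumFieldTheory.Balaban1983to89.B5Prop11Plancherel (Tor fine)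
open Literature.MathematicalPhysics.QuantumFieldTheory.Balaban1983to89.B5Block118 (bpt)
open Literature.MathematicalPhysics.QuantumFieldTheory.Balaban1983to89.B5Blocks16 (bpt_val bpt_bijective)
open Literature.MathematicalPhysics.QuantumFieldTheory.Balaban1983to89.B6LowerBound2153Torus (toT rep toT_rep)
open Literature.MathematicalPhysics.QuantumFieldTheory.Balaban1983to89.B6BondEliminationTorus (res pdist res_val)
open Literature.MathematicalPhysics.QuantumFieldTheory.Balaban1983to89.T4EtaRateCoeffDefect (fibre mem_fibre)
open Literature.MathematicalPhysics.QuantumFieldTheory.Balaban1983to89.B11SectG (RowSum)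
open Literature.MathematicalPhysics.QuantumFieldTheory.King1986.Torus (tdistT tdistT_triangle tdistT_symm tdistT_nonneg
  tdistT_self tdistT_sumBound val_blockOf toSite)

variable {d : ℕ}

/-! ## §1 The unit torus as a one-scale [B6] carrier -/

/-- THE ONE-SCALE UNIT-TORUS CARRIER: [B6]'s `𝔅` with a single layer `Λ_k` = the points of the unit torus `Π_ν ℤ∕M_ν` (`L^kη = 1`,
`η = L^{−k}`), distance `d(y, y′) = |y − y′|_{T,∞}` (the periodic sup-distance, `King1986.Torus.tdistT`), parameters `R = M = 1`,
(2.1)–(2.2) void, localisation ∕ cut-off sorts inert (one point, zero sizes); `reducible`, so that the `Fintype` ∕ `DecidableEq`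
instances of `Tor M` are found on its `Site`. [cite: Balaban1984PropagatorsII, (2.45)–(2.48) pp.229–231 (the carrier and its distance, one-scale instance); Balaban1987RG1, (1.9) p.252 (periodic distance on the torus)] -/
@[reducible] def unitTorusGeo (L k : ℕ) (M : Fin (d + 1) → ℕ) [∀ μ, NeZero (M μ)] : B6.Geometry where
  Site := Tor M
  fin := inferInstance
  scale := fun _ => k
  dist := fun y y' => tdistT M y y'
  k := k
  eta := ((L : ℝ) ^ k)⁻¹
  L := L
  R := 1
  M := 1
  Hyp21_22 := True
  Loc := Unit
  suppIn := fun _ _ => True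
  supNorm := fun _ => 0
  l2Norm := fun _ => 0
  holder := fun _ _ => 0
  Cut := Unit
  cutIn := fun _ _ => True
  cutH := fun _ _ => 0
  cutSup := fun _ => 0

section Carrier

variable (L k : ℕ) (M : Fin (d + 1) → ℕ) [hM : ∀ μ, NeZero (M μ)]

/-- The carrier distance IS King's periodic sup-distance (the one-scale reading of (2.46)). [cite: Balaban1984PropagatorsII, (2.46) p.231 (the distance, one-scale instance)] -/
@[simp] theorem unitTorusGeo_dist (y y' : (unitTorusGeo L k M).Site) : (unitTorusGeo L k M).dist y y' = tdistT M y y' := rfl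

/-- Every site has physical size `L^kη = 1` (`L ≠ 0`). [cite: Balaban1984PropagatorsII, (2.1)–(2.2) p.224 (top scale)] -/
theorem unitTorusGeo_len (hL : L ≠ 0) (y : (unitTorusGeo L k M).Site) : (unitTorusGeo L k M).len y = 1 := by
  show (L : ℝ) ^ k * ((L : ℝ) ^ k)⁻¹ = 1
  exact mul_inv_cancel₀ (pow_ne_zero _ (Nat.cast_ne_zero.mpr hL))

/-- **(2.54)** for the unit-torus carrier: the triangle inequality of the periodic sup-distance. [cite: Balaban1984PropagatorsII, (2.54) p.233] -/
theorem triangle254_unitTorusGeo : B6RandomWalk.Triangle254 (unitTorusGeo L k M) := fun a b c => tdistT_triangle M a b c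

/-- `d ≥ 0` for the one-scale distance (2.46). [cite: Balaban1984PropagatorsII, (2.46) p.231 (the distance, one-scale instance)] -/
theorem unitTorusGeo_dist_nonneg (y y' : (unitTorusGeo L k M).Site) : 0 ≤ (unitTorusGeo L k M).dist y y' :=
  tdistT_nonneg M y y'

/-- `d` is symmetric (the one-scale distance (2.46)). [cite: Balaban1984PropagatorsII, (2.46) p.231 (the distance, one-scale instance)] -/
theorem unitTorusGeo_dist_symm (y y' : (unitTorusGeo L k M).Site) :
    (unitTorusGeo L k M).dist y y' = (unitTorusGeo L k M).dist y' y :=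
  tdistT_symm M y y'

/-- `d(y, y) = 0` (the one-scale distance (2.46)). [cite: Balaban1984PropagatorsII, (2.46) p.231 (the distance, one-scale instance)] -/
theorem unitTorusGeo_dist_self (y : (unitTorusGeo L k M).Site) : (unitTorusGeo L k M).dist y y = 0 := tdistT_self M y

/-- **(2.61)** for the unit-torus carrier, UNIFORMLY IN THE VOLUME: `Σ_{y′} e^{−σ|y − y′|_T} ≤ K_{d+1}(σ)` for every `σ > 0`
(`K = B4Sect5Proof.latticeConst`; `King1986.Torus.tdistT_sumBound` BY NAME). [cite: Balaban1984PropagatorsII, Lemma 2.1 (2.61) p.234] -/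
theorem rowSum_unitTorusGeo {σ : ℝ} (hσ : 0 < σ) : RowSum (unitTorusGeo L k M) σ (B4Sect5Proof.latticeConst (d + 1) σ) :=
  fun y => tdistT_sumBound M σ hσ y

end Carrier

/-! ## §2 The bond assignments of the N15 chain and their block counts -/

section Bonds

variable (n : ℕ) [NeZero n] (M : Fin (d + 1) → ℕ) [hM : ∀ μ, NeZero (M μ)]

omit [NeZero n] in
/-- UNIT BONDS over their base point: the fibre of `(y, λ) ↦ y` over `y` is `{y} × {directions}`, `d + 1` bonds.
[cite: Balaban1984PropagatorsII, (2.150) p.249 (bonds b ∈ Δ(y))] -/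
theorem card_fibre_unitBond (y : Tor M) :
    (fibre (fun b : Tor M × Fin (d + 1) => b.1) y).card = d + 1 := by
  have h : fibre (fun b : Tor M × Fin (d + 1) => b.1) y =
      (Finset.univ : Finset (Fin (d + 1))).map ⟨fun lam => (y, lam), fun a b hab => (Prod.mk.inj hab).2⟩ := by
    ext ⟨y₁, lam⟩
    simp only [mem_fibre, Finset.mem_map, Finset.mem_univ, true_and, Function.Embedding.coeFn_mk, Prod.mk.injEq]
    constructor
    · rintro rfl; exact ⟨lam, rfl, rfl⟩
    · rintro ⟨a, rfl, rfl⟩; rfl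
  rw [h, Finset.card_map, Finset.card_univ, Fintype.card_fin]

/-- FINE SITES over a unit block: the fibre of King's `King1986.Torus.blockOf n M` over `y` is the block `{n·y + a : a ∈ [0, n)^{d+1}}`, `n^{d+1}` points
(b05's block parametrisation `B5Blocks16.bpt_bijective`). [cite: Balaban1984PropagatorsI, (1.6) p.18 (the blocks partition the torus)] -/
theorem card_fibre_blockOf (y : Tor M) : (fibre (King1986.Torus.blockOf n M) y).card = n ^ (d + 1) := by
  classical
  have hn : 0 < n := Nat.pos_of_ne_zero (NeZero.ne n)
  have hblk : ∀ (y' : Tor M) (a : Fin (d + 1) → Fin n), King1986.Torus.blockOf n M (bpt n M y' a) = y' := fun y' a => by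
    funext ν
    apply ZMod.val_injective
    rw [val_blockOf, bpt_val, Nat.mul_add_div hn, Nat.div_eq_of_lt (a ν).isLt, add_zero]
  have h : fibre (King1986.Torus.blockOf n M) y =
      (Finset.univ : Finset (Fin (d + 1) → Fin n)).map
        ⟨fun a => bpt n M y a, fun a b hab =>
          (Prod.mk.inj ((bpt_bijective n M).1 (a₁ := (y, a)) (a₂ := (y, b)) hab)).2⟩ := by
    ext x
    simp only [mem_fibre, Finset.mem_map, Finset.mem_univ, true_and, Function.Embedding.coeFn_mk]
    constructor
    · intro hx
      obtain ⟨⟨y', a⟩, rfl⟩ := (bpt_bijective n M).2 x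
      simp only at hx
      rw [hblk] at hx
      subst hx
      exact ⟨a, rfl⟩
    · rintro ⟨a, rfl⟩
      exact hblk y a
  rw [h, Finset.card_map, Finset.card_univ, Fintype.card_fun, Fintype.card_fin, Fintype.card_fin]

/-- FINE BONDS over a unit block: the fibre of `(x, μ) ↦ B(x)` over `y` has `(d + 1)·n^{d+1}` bonds. [cite: Balaban1984PropagatorsII, (2.150) p.249 (bonds in Δ(y))] -/
theorem card_fibre_fineBond (y : Tor M) :
    (fibre (fun i : Tor (fine n M) × Fin (d + 1) => King1986.Torus.blockOf n M i.1) y).card = (d + 1) * n ^ (d + 1) := by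
  classical
  have h : fibre (fun i : Tor (fine n M) × Fin (d + 1) => King1986.Torus.blockOf n M i.1) y = (fibre (King1986.Torus.blockOf n M) y) ×ˢ Finset.univ := by
    ext ⟨x, μ⟩
    simp only [mem_fibre, Finset.mem_product, Finset.mem_univ, and_true]
  rw [h, Finset.card_product, card_fibre_blockOf, Finset.card_univ, Fintype.card_fin, mul_comm]

end Bonds

/-! ## §3 b06's periodic bond distance on box representatives IS King's `tdistT` -/

section Dist

variable (M : Fin (d + 1) → ℕ) [hM : ∀ μ, NeZero (M μ)]

/-- The residue of the box representative of a torus point is the point's own coordinate tuple (the torus read in coordinates, B12 (1.9)). [cite: Balaban1987RG1, (1.9) p.252 (periodic distance on the torus, coordinates)] -/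
theorem res_rep (hM1 : ∀ i, 1 ≤ M i) (u : Tor M) : res M hM1 (rep M u) = toSite M u := by
  funext i
  apply Fin.ext
  have h := res_val M hM1 (rep M u) i
  have hlt : ((u i).val : ℤ) < (M i : ℤ) := by exact_mod_cast ZMod.val_lt (u i)
  have hmod : ((u i).val : ℤ) % (M i : ℤ) = (u i).val := Int.emod_eq_of_lt (Int.natCast_nonneg _) hlt
  have h' : ((res M hM1 (rep M u) i).val : ℤ) = ((u i).val : ℤ) := by rw [h]; exact hmod
  exact_mod_cast h'

/-- **`ρ_M(rep y, rep y′) = |y − y′|_T`**: b06's periodic bond distance `pdist` of box representatives IS King's periodic sup-distance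
of the torus points (both are `max_ν dist(y_ν − y′_ν, M_νℤ)`). [cite: Balaban1987RG1, (1.9) p.252 («periodic distance on the torus»)] -/
theorem pdist_rep_rep (hM1 : ∀ i, 1 ≤ M i) (u v : Tor M) : pdist M hM1 (rep M u) (rep M v) = tdistT M u v := by
  unfold pdist
  rw [res_rep M hM1 u, res_rep M hM1 v]
  rfl

end Dist

end Literature.MathematicalPhysics.QuantumFieldTheory.Balaban1983to89.B6UnitTorusCarrier
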